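import Mathlib
import Summits.Ventures.PercRepro2.HCovSwap
import Summits.Ventures.PercRepro2.BHKAvoid
import Summits.Ventures.PercRepro2.BHKEvents
import Summits.Ventures.PercRepro2.ExploreA3
import Summits.Ventures.PercRepro2.OrderPreservation
import Summits.Ventures.PercRepro2.RootLeafA3
import Summits.Ventures.PercRepro2.RootLeafOCells
import Summits.Ventures.PercRepro2.RootLeafBEvents
import Summits.Ventures.PercRepro2.RootLeafBCells
import Summits.Ventures.PercRepro2.RootLeafBAtoms1
import Summits.Ventures.PercRepro2.RootLeafBAtoms2
import Summits.Ventures.PercRepro2.RootLeafBKernelCells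
import Summits.Ventures.PercRepro2.RootLeafBIdentity

/-!
# (HCOV) when a ROOT is a leaf at `b` — the (G4-b) theorem (blind cell PercRepro2, p4 g2; S3 GAP
(G4), the third root-leaf class: proofs/subclaims/S3-CLASSES.md §S3.10 (G4-b), proofs/P4-ROOTLEAF-B.md)

Let the root `a₁` be a LEAF attached to `b` by the single edge `f` of weight `q = p f`, with
`a₂, a₃, o ≠ a₁` (`G − a₁` arbitrary).  In the `(b, a₂)`-world of `G − a₁` (`Q = {b ↮ a₂}`,
`Z = P(Q)`, `L = C(b)`, `H = C(a₂)`, `N` = neither, `D₁ = P(Q, a₃ ∈ N)`, `X_L = P(Q, a₃ ∈ L)`,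
`X_H = P(Q, a₃ ∈ H)`, `M_st = P(Q, o ∈ s, a₃ ∈ t)`, `d₀ = P(a₃ ↮ a₂)`, `e₀ = P(o ↔ a₂, a₃ ↮ a₂)`,
`hb = P(b ↔ a₂)`, `S = P(Ω)`):

* **`Gc_root_leaf_b`**: `S·Gc = q(1−q)²·S·U + q²(1−q)·2·S·C` with `U` p4 g0's first coefficient
  (`2S[d₀·P(oH,bH,a₃∉H) − e₀·P(bH,a₃∉H)] + 2hb[e₀·X_L − d₀·M_HL] + 2S·d₀·M_LH + 2hb·d₀·P(Q,oL,a₃∉L)`)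
  and `C = (2S−Z)D₁M_LH + G₂M_LN − 2(S−Z)D₁M_HL + G₃M_HN + Z·D₁·P(bH,oH,a₃∉H)` the second — a
  polynomial identity in the fifteen cells (`RootLeafBAtoms1/2`) after the two-world rewrites
  (`RootLeafBEvents`, the `Q`-masses from `RootLeafA3` with the attachment vertex `b`).
* The signs: **(L1)** `e₀·P(bH,a₃∉H) ≤ d₀·P(oH,bH,a₃∉H)` = BHK06 1.3 (`bhk_same_cluster_events`);
  **(L2)** `d₀·M_HL ≤ e₀·X_L` and **(★c)** `D₁·M_HL ≤ X_L·M_HN` = BHK06 1.4 with avoidance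
  (`bhk_cross_cluster_avoid`: explore `C(a₃)` avoiding `a₂`, resp. `C(a₂)` avoiding `{b, a₃}`);
  **(P1′)** `(M_LN + M_HN)·P(bH,a₃∉H) ≤ D₁·P(bH,oH,a₃∉H)` = explore `C(a₃)` avoiding `{b, a₂}`,
  Harris in the residual for `{b ↔ a₂}` and `{o ↔ a₂ ∨ o ↔ b}`, BHK06 1.1 (`bhk_induced`) for the
  two decreasing residual functionals; **`Cform_decomp`**: `C = N + Z·slack(P1′) + 2(S−Z)·slack(★c)`
  with `N ≥ 0` (a `ring` identity in the cells).
* **`HCov_root_leaf_b`** assembles them; **`HCov_root_leaf_b'`** is the root-swapped form.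
-/

namespace Summit.Ventures.PercRepro2

open UnionCluster CovForm PendantRoot RootLeafO

namespace RootLeafB

variable {V : Type*} {E : Type*} [Fintype E] [DecidableEq E] {R : Type*} [Field R]
  [LinearOrder R] [IsStrictOrderedRing R]

/-! ## The sign lemmas: kernel instances of BHK06 1.3 / 1.4 with avoidance -/

section Signs

variable [Fintype V] [DecidableEq V] (p : E → R) (ends : E → Sym2 V) (o a₂ a₃ b : V)

/-- **(L1)** `e₀·P(bH, a₃∉H) ≤ d₀·P(oH, bH, a₃∉H)`: BHK06 1.3 (same cluster `C(a₂)` given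
`a₂ ↮ a₃`, `bhk_same_cluster_events`). -/
lemma L1 (hp : IsProbVec p) :
    prob p (connEvent ends o a₂ ∩ (connEvent ends a₂ a₃)ᶜ) *
        prob p (connEvent ends a₂ b ∩ (connEvent ends a₂ a₃)ᶜ) ≤
      prob p (avoidAll ends a₂ {a₃}) *
        prob p (connEvent ends o a₂ ∩ connEvent ends a₂ b ∩ (connEvent ends a₂ a₃)ᶜ) := by
  have h := bhk_same_cluster_events p hp ends a₂ a₃ (isUpperSet_mem_setOf o) (isUpperSet_mem_setOf b)
  rw [cellsK_k_L1_U p ends o a₂ a₃ b, cellsK_k_L1_V p ends o a₂ a₃ b, cellsK_k_L1_UV p ends o a₂ a₃ b,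
    cellsK_k_H3c p ends o a₂ a₃ b] at h
  rw [cellsB_e0 p ends o a₂ a₃ b, cellsB_a2b_cnH p ends o a₂ a₃ b, cellsB_N3 p ends o a₂ a₃ b,
    cellsB_oa2_a2b_cnH p ends o a₂ a₃ b]
  nlinarith [h]

/-- **(L2)** `d₀·M_HL ≤ e₀·X_L`: BHK06 1.4 (`bhk_cross_cluster_avoid`, explore `C(a₃)` avoiding
`a₂`; `b ∈ C(a₃)` against `o ∈ C(a₂)` in the residual). -/
lemma L2 (hp : IsProbVec p) :
    prob p (avoidAll ends a₂ {a₃}) * prob p (TEvent ends a₂ b a₃ ∩ connEvent ends a₂ o) ≤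
      prob p (connEvent ends o a₂ ∩ (connEvent ends a₂ a₃)ᶜ) * prob p (TEvent ends a₂ b a₃) := by
  have h := bhk_cross_cluster_avoid p hp ends a₃ a₂ (X := {a₂}) (Finset.mem_singleton_self a₂)
    (isUpperSet_mem_setOf b) (isUpperSet_mem_setOf o)
  rw [cellsK_k_L2_full p ends o a₂ a₃ b, cellsK_k_R2 p ends o a₂ a₃ b, cellsK_k_L2_U p ends o a₂ a₃ b,
    cellsK_k_L2_V p ends o a₂ a₃ b] at h
  rw [cellsB_N3 p ends o a₂ a₃ b, cellsB_Tp1b_a2o p ends o a₂ a₃ b, cellsB_e0 p ends o a₂ a₃ b,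
    cellsB_Tp1b p ends o a₂ a₃ b]
  nlinarith [h]

/-- **(★c)** `D₁·M_HL ≤ X_L·M_HN`: BHK06 1.4 (`bhk_cross_cluster_avoid`, explore `C(a₂)` avoiding
`{b, a₃}`; `o ∈ C(a₂)` against `a₃ ∈ C(b)` in the residual). -/
lemma starc (hp : IsProbVec p) :
    prob p (PDEvent ends b a₂ a₃) * prob p (TEvent ends a₂ b a₃ ∩ connEvent ends a₂ o) ≤
      prob p (TEvent ends a₂ b a₃) * prob p (PDEvent ends b a₂ a₃ ∩ connEvent ends a₂ o) := by
  have h := bhk_cross_cluster_avoid p hp ends a₂ b (X := {b, a₃}) (Finset.mem_insert_self b {a₃})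
    (isUpperSet_mem_setOf o) (isUpperSet_mem_setOf a₃)
  rw [cellsK_k_c_full p ends o a₂ a₃ b, cellsK_k_Rc p ends o a₂ a₃ b, cellsK_k_c_U p ends o a₂ a₃ b,
    cellsK_k_c_V p ends o a₂ a₃ b] at h
  rw [cellsB_PD1b p ends o a₂ a₃ b, cellsB_Tp1b_a2o p ends o a₂ a₃ b, cellsB_Tp1b p ends o a₂ a₃ b,
    cellsB_PD1b_a2o p ends o a₂ a₃ b]
  nlinarith [h]

/-- **(P1′)** `(M_LN + M_HN)·P(bH, a₃∉H) ≤ D₁·P(bH, oH, a₃∉H)` («given `a₃` attaches to neither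
root cluster, `o` attaches to the merged cluster at least as easily as to the two separated
ones»): explore `K = C(a₃)` avoiding `{b, a₂}`; in the residual `G ∖ K`, Harris for `{b ↔ a₂}`
and `{o ↔ a₂ ∨ o ↔ b}`, then BHK06 1.1 (`bhk_induced`) for the two decreasing residual
functionals. -/
lemma P1' (hp : IsProbVec p) :
    (prob p (PDEvent ends b a₂ a₃ ∩ connEvent ends b o) +
        prob p (PDEvent ends b a₂ a₃ ∩ connEvent ends a₂ o)) *
        prob p (connEvent ends a₂ b ∩ (connEvent ends a₂ a₃)ᶜ) ≤
      prob p (PDEvent ends b a₂ a₃) *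
        prob p (connEvent ends o a₂ ∩ connEvent ends a₂ b ∩ (connEvent ends a₂ a₃)ᶜ) := by
  classical
  set N := avoidAll ends a₃ {b, a₂} with hN
  have hb2 : a₂ ∈ ({b, a₂} : Finset V) := by simp
  have hbb : b ∈ ({b, a₂} : Finset V) := by simp
  -- the residual functionals of the explored cluster `K = C(a₃)`
  set gb := delClusterProb p ends a₂ {W | b ∈ W} with hgb
  set go := delClusterProb p ends a₂ {W | o ∈ W} with hgo
  set gob := delClusterProb p ends a₂ ({W | b ∈ W} ∩ {W | o ∈ W}) with hgob
  set go' := delClusterProb p ends b {W | o ∈ W} with hgo'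
  set u : Set V → R := fun K =>
    prob p {ω | delConfig ends K ω ∈ connEvent ends a₂ o ∪ connEvent ends b o} with hu
  -- tower identities
  have eU : ∀ A : Set (Config E), clusterInEvent ends a₃ Set.univ ∩ A = A := by
    intro A; ext ω; simp only [Set.mem_inter_iff, mem_clusterInEvent, Set.mem_univ, true_and]
  have tb := prob_clusterIn_inter_avoid_eq_expect p ends a₃ a₂ hb2 Set.univ {W | b ∈ W}
  have tob := prob_clusterIn_inter_avoid_eq_expect p ends a₃ a₂ hb2 Set.univ
    ({W | b ∈ W} ∩ {W | o ∈ W})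
  have tO := prob_clusterIn_inter_avoid_eq_expect p ends a₃ a₂ hb2 Set.univ {W | o ∈ W}
  have tO' := prob_clusterIn_inter_avoid_eq_expect p ends a₃ b hbb Set.univ {W | o ∈ W}
  simp only [Set.indicator_univ, Pi.one_apply, one_mul, eU] at tb tob tO tO'
  -- `u = go + go' − gob` pointwise (inclusion–exclusion in the residual)
  have hu_eq : ∀ K, u K = go K + go' K - gob K := by
    intro K
    simp only [hu, hgo, hgo', hgob, delClusterProb]
    have e1 : {ω : Config E | delConfig ends K ω ∈ connEvent ends a₂ o ∪ connEvent ends b o} =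
        {ω | cluster ends (delConfig ends K ω) a₂ ∈ {W | o ∈ W}} ∪
          {ω | cluster ends (delConfig ends K ω) b ∈ {W | o ∈ W}} := by
      ext ω
      simp only [Set.mem_setOf_eq, Set.mem_union, mem_connEvent, mem_cluster]
    have e2 : {ω : Config E | cluster ends (delConfig ends K ω) a₂ ∈ {W | o ∈ W}} ∩
        {ω | cluster ends (delConfig ends K ω) b ∈ {W | o ∈ W}} =
        {ω | cluster ends (delConfig ends K ω) a₂ ∈ {W | b ∈ W} ∩ {W | o ∈ W}} := by
      ext ω
      simp only [Set.mem_setOf_eq, Set.mem_inter_iff, mem_cluster]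
      constructor
      · rintro ⟨h1, h2⟩; exact ⟨conn_trans h1 (conn_symm h2), h1⟩
      · rintro ⟨h1, h2⟩; exact ⟨h2, conn_trans (conn_symm h1) h2⟩
    rw [e1]
    have := prob_union_add_prob_inter p {ω : Config E | cluster ends (delConfig ends K ω) a₂ ∈ {W | o ∈ W}}
      {ω | cluster ends (delConfig ends K ω) b ∈ {W | o ∈ W}}
    rw [e2] at this
    linarith
  -- pointwise Harris in the residual: `gob ≥ gb · u`
  have hpt : ∀ K, gb K * u K ≤ gob K := by
    intro K
    simp only [hgb, hgob, hu, delClusterProb]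
    have hX : IsUpperSet {ω : Config E | cluster ends (delConfig ends K ω) a₂ ∈ {W | b ∈ W}} :=
      ExploreA3.isUpperSet_delCluster ends a₂ K (ExploreA3.isUpperSet_mem b)
    have hY : IsUpperSet {ω : Config E | delConfig ends K ω ∈ connEvent ends a₂ o ∪ connEvent ends b o} := by
      intro ω ω' h hω
      exact (isUpperSet_connEvent ends a₂ o).union (isUpperSet_connEvent ends b o)
        (ExploreA3.delConfig_mono ends K h) hω
    have h := prob_mul_prob_le_prob_inter hp hX hY
    have e : {ω : Config E | cluster ends (delConfig ends K ω) a₂ ∈ {W | b ∈ W}} ∩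
        {ω | delConfig ends K ω ∈ connEvent ends a₂ o ∪ connEvent ends b o} =
        {ω | cluster ends (delConfig ends K ω) a₂ ∈ {W | b ∈ W} ∩ {W | o ∈ W}} := by
      ext ω
      simp only [Set.mem_setOf_eq, Set.mem_inter_iff, Set.mem_union, mem_connEvent, mem_cluster]
      constructor
      · rintro ⟨h1, h2 | h2⟩
        · exact ⟨h1, h2⟩
        · exact ⟨h1, conn_trans h1 h2⟩
      · rintro ⟨h1, h2⟩; exact ⟨h1, Or.inl h2⟩
    rw [e] at h
    exact h
  -- antitonicity and bounds of the residual functionals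
  have hu_anti : Antitone u := by
    intro K K' h
    simp only [hu]
    refine prob_mono hp fun ω hω => ?_
    exact (isUpperSet_connEvent ends a₂ o).union (isUpperSet_connEvent ends b o)
      (delConfig_anti h ω) hω
  have hgb_anti : Antitone gb := delClusterProb_anti p hp ends a₂ (ExploreA3.isUpperSet_mem b)
  have hu1 : ∀ K, u K ≤ 1 := fun K => prob_le_one hp _
  have hgb1 : ∀ K, gb K ≤ 1 := delClusterProb_le_one p hp ends a₂ _
  have hF₁ : Monotone (fun K => 1 - u K) := fun K K' h => by simp only; linarith [hu_anti h]
  have hF₂ : Monotone (fun K => 1 - gb K) := fun K K' h => by simp only; linarith [hgb_anti h]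
  have hF₁0 : ∀ K, 0 ≤ 1 - u K := fun K => by linarith [hu1 K]
  have hF₂0 : ∀ K, 0 ≤ 1 - gb K := fun K => by linarith [hgb1 K]
  -- the functional BHK for `1 − u`, `1 − gb` on the cluster of `a₃` avoiding `{b, a₂}`
  have key := bhk_induced p hp ends a₃ hF₁ hF₂ hF₁0 hF₂0 Finset.univ {b, a₂} {b, a₂}
    (Finset.subset_univ _) (Finset.subset_univ _)
  simp only [Finset.inter_self, Finset.union_self, REvent_univ] at key
  have e : ∀ F : Set V → R, clusterObs ends Finset.univ a₃ F * (avoidAll ends a₃ {b, a₂}).indicator 1 =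
      fun ω => F (cluster ends ω a₃) * (avoidAll ends a₃ {b, a₂}).indicator 1 ω := by
    intro F
    funext ω
    simp only [Pi.mul_apply, clusterObs_apply, clusterIn_univ]
  rw [e, e, e] at key
  simp only [Pi.mul_apply] at key
  have eN : prob p N = expect p fun ω => N.indicator 1 ω := prob_eq_expect_indicator p _
  -- the expectations in terms of masses
  have eu : expect p (fun ω => u (cluster ends ω a₃) * N.indicator 1 ω) =
      prob p (clusterInEvent ends a₂ {W | o ∈ W} ∩ N) +
        prob p (clusterInEvent ends b {W | o ∈ W} ∩ N) -
        prob p (clusterInEvent ends a₂ ({W | b ∈ W} ∩ {W | o ∈ W}) ∩ N) := by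
    rw [tO, tO', tob, ← expect_add, ← expect_sub]
    congr 1
    funext ω
    simp only [Pi.sub_apply, Pi.add_apply]
    rw [hu_eq]
    ring
  have e1 : expect p (fun ω => (1 - u (cluster ends ω a₃)) * N.indicator 1 ω) =
      prob p N - (prob p (clusterInEvent ends a₂ {W | o ∈ W} ∩ N) +
        prob p (clusterInEvent ends b {W | o ∈ W} ∩ N) -
        prob p (clusterInEvent ends a₂ ({W | b ∈ W} ∩ {W | o ∈ W}) ∩ N)) := by
    rw [← eu, eN, ← expect_sub]
    congr 1
    funext ω
    simp only [Pi.sub_apply]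
    ring
  have e2 : expect p (fun ω => (1 - gb (cluster ends ω a₃)) * N.indicator 1 ω) =
      prob p N - prob p (clusterInEvent ends a₂ {W | b ∈ W} ∩ N) := by
    rw [tb, eN, ← expect_sub]
    congr 1
    funext ω
    simp only [Pi.sub_apply]
    ring
  have e12 : expect p (fun ω => (1 - u (cluster ends ω a₃)) * (1 - gb (cluster ends ω a₃)) *
      N.indicator 1 ω) = prob p N - (prob p (clusterInEvent ends a₂ {W | o ∈ W} ∩ N) +
        prob p (clusterInEvent ends b {W | o ∈ W} ∩ N) -
        prob p (clusterInEvent ends a₂ ({W | b ∈ W} ∩ {W | o ∈ W}) ∩ N)) -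
      prob p (clusterInEvent ends a₂ {W | b ∈ W} ∩ N) +
      expect p (fun ω => u (cluster ends ω a₃) * gb (cluster ends ω a₃) * N.indicator 1 ω) := by
    rw [← eu, tb, eN, ← expect_sub, ← expect_sub, ← expect_add]
    congr 1
    funext ω
    simp only [Pi.sub_apply, Pi.add_apply]
    ring
  rw [e1, e2, e12] at key
  -- `E[u gb 1_N] ≤ E[gob 1_N] = P(N, b ↔ a₂, o ↔ a₂)`
  have hE : expect p (fun ω => u (cluster ends ω a₃) * gb (cluster ends ω a₃) * N.indicator 1 ω) ≤
      prob p (clusterInEvent ends a₂ ({W | b ∈ W} ∩ {W | o ∈ W}) ∩ N) := by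
    rw [tob]
    refine expect_mono hp fun ω => ?_
    have := hpt (cluster ends ω a₃)
    rw [mul_comm (gb _) (u _)] at this
    exact mul_le_mul_of_nonneg_right this (Set.indicator_apply_nonneg fun _ => zero_le_one)
  have hn0 : 0 ≤ prob p N := prob_nonneg hp _
  have hmain : (prob p (clusterInEvent ends a₂ {W | o ∈ W} ∩ N) +
        prob p (clusterInEvent ends b {W | o ∈ W} ∩ N) -
        prob p (clusterInEvent ends a₂ ({W | b ∈ W} ∩ {W | o ∈ W}) ∩ N)) *
      prob p (clusterInEvent ends a₂ {W | b ∈ W} ∩ N) ≤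
      prob p N * prob p (clusterInEvent ends a₂ ({W | b ∈ W} ∩ {W | o ∈ W}) ∩ N) := by
    nlinarith [key, hE, hn0]
  -- everything in cells
  rw [hN] at hmain
  rw [cellsK_k_N_o p ends o a₂ a₃ b, cellsK_k_N_ob p ends o a₂ a₃ b, cellsK_k_N_bo p ends o a₂ a₃ b,
    cellsK_k_N_b p ends o a₂ a₃ b, cellsK_k_N p ends o a₂ a₃ b] at hmain
  rw [cellsB_PD1b_bo p ends o a₂ a₃ b, cellsB_PD1b_a2o p ends o a₂ a₃ b, cellsB_a2b_cnH p ends o a₂ a₃ b,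
    cellsB_PD1b p ends o a₂ a₃ b, cellsB_oa2_a2b_cnH p ends o a₂ a₃ b]
  nlinarith [hmain]

omit [LinearOrder R] [IsStrictOrderedRing R] in
/-- The decomposition of the second coefficient: `C = N + Z·slack₁ + 2(S − Z)·slack₂`. -/
lemma Cform_decomp :
    (2 * prob p Set.univ - prob p (avoidAll ends a₂ {b})) * prob p (PDEvent ends b a₂ a₃) *
          prob p (TEvent ends b a₂ a₃ ∩ connEvent ends b o) +
        ((prob p Set.univ - prob p (avoidAll ends a₂ {b})) *
            (prob p (avoidAll ends a₂ {b}) - 2 * prob p (TEvent ends b a₂ a₃)) +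
          prob p (avoidAll ends a₂ {b}) * prob p (connEvent ends a₂ a₃ ∩ connEvent ends a₂ b)) *
          prob p (PDEvent ends b a₂ a₃ ∩ connEvent ends b o) -
        2 * (prob p Set.univ - prob p (avoidAll ends a₂ {b})) * prob p (PDEvent ends b a₂ a₃) *
          prob p (TEvent ends a₂ b a₃ ∩ connEvent ends a₂ o) +
        ((prob p Set.univ - prob p (avoidAll ends a₂ {b})) *
            (prob p (TEvent ends a₂ b a₃) - prob p (PDEvent ends b a₂ a₃) -
              prob p (TEvent ends b a₂ a₃)) +
          prob p (avoidAll ends a₂ {b}) * prob p (connEvent ends a₂ a₃ ∩ connEvent ends a₂ b)) *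
          prob p (PDEvent ends b a₂ a₃ ∩ connEvent ends a₂ o) +
        prob p (avoidAll ends a₂ {b}) * prob p (PDEvent ends b a₂ a₃) *
          prob p (connEvent ends o a₂ ∩ connEvent ends a₂ b ∩ (connEvent ends a₂ a₃)ᶜ) =
      (prob p Set.univ * prob p (PDEvent ends b a₂ a₃) *
          prob p (TEvent ends b a₂ a₃ ∩ connEvent ends b o) +
        (prob p Set.univ - prob p (avoidAll ends a₂ {b})) *
          (prob p (PDEvent ends b a₂ a₃) * prob p (TEvent ends b a₂ a₃ ∩ connEvent ends b o) +
            2 * prob p (PDEvent ends b a₂ a₃ ∩ connEvent ends b o) *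
              (prob p (TEvent ends a₂ b a₃) + prob p (PDEvent ends b a₂ a₃)))) +
      prob p (avoidAll ends a₂ {b}) *
        (prob p (PDEvent ends b a₂ a₃) *
            prob p (connEvent ends o a₂ ∩ connEvent ends a₂ b ∩ (connEvent ends a₂ a₃)ᶜ) -
          (prob p (PDEvent ends b a₂ a₃ ∩ connEvent ends b o) +
              prob p (PDEvent ends b a₂ a₃ ∩ connEvent ends a₂ o)) *
            prob p (connEvent ends a₂ b ∩ (connEvent ends a₂ a₃)ᶜ)) +
      2 * (prob p Set.univ - prob p (avoidAll ends a₂ {b})) *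
        (prob p (TEvent ends a₂ b a₃) * prob p (PDEvent ends b a₂ a₃ ∩ connEvent ends a₂ o) -
          prob p (PDEvent ends b a₂ a₃) * prob p (TEvent ends a₂ b a₃ ∩ connEvent ends a₂ o)) := by
  rw [cellsB_univ p ends o a₂ a₃ b, cellsB_Qb p ends o a₂ a₃ b, cellsB_PD1b p ends o a₂ a₃ b,
    cellsB_T1b_bo p ends o a₂ a₃ b, cellsB_T1b p ends o a₂ a₃ b, cellsB_H3_a2b p ends o a₂ a₃ b,
    cellsB_PD1b_bo p ends o a₂ a₃ b, cellsB_Tp1b_a2o p ends o a₂ a₃ b, cellsB_Tp1b p ends o a₂ a₃ b,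
    cellsB_PD1b_a2o p ends o a₂ a₃ b, cellsB_oa2_a2b_cnH p ends o a₂ a₃ b,
    cellsB_a2b_cnH p ends o a₂ a₃ b]
  ring

end Signs

/-! ## The theorem -/

section TheoremB

variable [Fintype V] [DecidableEq V] (p : E → R) (ends : E → Sym2 V)

/-- **(HCOV) when the root `a₁` is a leaf at `b`**, for every weight of the leaf edge and every
`G − a₁` (p4 g2, S3 (G4-b), proofs/P4-ROOTLEAF-B.md). -/
theorem HCov_root_leaf_b (hp : IsProbVec p) {f : E} {a₁ b : V} (hf : ends f = s(a₁, b))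
    (hleaf : ∀ e, a₁ ∈ ends e → e = f) (h1b : a₁ ≠ b) {o a₂ a₃ : V} (h12 : a₁ ≠ a₂)
    (h13 : a₁ ≠ a₃) (ho : o ≠ a₁) : HCov p ends o a₁ a₂ a₃ b := by
  unfold HCov
  have hid := Gc_root_leaf_b p ends hf hleaf h1b h12 h13 ho
  have hdec := Cform_decomp p ends o a₂ a₃ b
  rw [hdec] at hid
  simp only [prob_univ, one_mul, mul_one] at hid
  rw [hid]
  have hq0 := hp.nonneg f
  have hq1 := sub_nonneg.2 (hp.le_one f)
  have hZ := prob_nonneg hp (avoidAll ends a₂ {b})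
  have hZ1 : 0 ≤ 1 - prob p (avoidAll ends a₂ {b}) := sub_nonneg.2 (prob_le_one hp _)
  have hd0 := prob_nonneg hp (avoidAll ends a₂ {a₃})
  have hD1 := prob_nonneg hp (PDEvent ends b a₂ a₃)
  have hXL := prob_nonneg hp (TEvent ends a₂ b a₃)
  have hMLH := prob_nonneg hp (TEvent ends b a₂ a₃ ∩ connEvent ends b o)
  have hMLN := prob_nonneg hp (PDEvent ends b a₂ a₃ ∩ connEvent ends b o)
  have hhb := prob_nonneg hp (connEvent ends a₂ b)
  have hQoL := prob_nonneg hp (avoidAll ends a₂ {b} ∩ connEvent ends b o ∩ (connEvent ends b a₃)ᶜ)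
  have hL1 := L1 p ends o a₂ a₃ b hp
  have hL2 := L2 p ends o a₂ a₃ b hp
  have hc := starc p ends o a₂ a₃ b hp
  have hP := P1' p ends o a₂ a₃ b hp
  have hU : 0 ≤ 2 * (prob p (avoidAll ends a₂ {a₃}) *
        prob p (connEvent ends o a₂ ∩ connEvent ends a₂ b ∩ (connEvent ends a₂ a₃)ᶜ) -
      prob p (connEvent ends o a₂ ∩ (connEvent ends a₂ a₃)ᶜ) *
        prob p (connEvent ends a₂ b ∩ (connEvent ends a₂ a₃)ᶜ)) +
      2 * prob p (connEvent ends a₂ b) *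
        (prob p (connEvent ends o a₂ ∩ (connEvent ends a₂ a₃)ᶜ) * prob p (TEvent ends a₂ b a₃) -
          prob p (avoidAll ends a₂ {a₃}) * prob p (TEvent ends a₂ b a₃ ∩ connEvent ends a₂ o)) +
      2 * prob p (avoidAll ends a₂ {a₃}) * prob p (TEvent ends b a₂ a₃ ∩ connEvent ends b o) +
      2 * prob p (connEvent ends a₂ b) * prob p (avoidAll ends a₂ {a₃}) *
        prob p (avoidAll ends a₂ {b} ∩ connEvent ends b o ∩ (connEvent ends b a₃)ᶜ) := by
    have e1 := sub_nonneg.2 hL1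
    have e2 := sub_nonneg.2 hL2
    have two : (0 : R) ≤ 2 := by norm_num
    exact add_nonneg (add_nonneg (add_nonneg (mul_nonneg two e1) (mul_nonneg (mul_nonneg two hhb) e2))
      (mul_nonneg (mul_nonneg two hd0) hMLH)) (mul_nonneg (mul_nonneg (mul_nonneg two hhb) hd0) hQoL)
  have hC : 0 ≤ (prob p (PDEvent ends b a₂ a₃) * prob p (TEvent ends b a₂ a₃ ∩ connEvent ends b o) +
        (1 - prob p (avoidAll ends a₂ {b})) *
          (prob p (PDEvent ends b a₂ a₃) * prob p (TEvent ends b a₂ a₃ ∩ connEvent ends b o) +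
            2 * prob p (PDEvent ends b a₂ a₃ ∩ connEvent ends b o) *
              (prob p (TEvent ends a₂ b a₃) + prob p (PDEvent ends b a₂ a₃)))) +
      prob p (avoidAll ends a₂ {b}) *
        (prob p (PDEvent ends b a₂ a₃) *
            prob p (connEvent ends o a₂ ∩ connEvent ends a₂ b ∩ (connEvent ends a₂ a₃)ᶜ) -
          (prob p (PDEvent ends b a₂ a₃ ∩ connEvent ends b o) +
              prob p (PDEvent ends b a₂ a₃ ∩ connEvent ends a₂ o)) *
            prob p (connEvent ends a₂ b ∩ (connEvent ends a₂ a₃)ᶜ)) +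
      2 * (1 - prob p (avoidAll ends a₂ {b})) *
        (prob p (TEvent ends a₂ b a₃) * prob p (PDEvent ends b a₂ a₃ ∩ connEvent ends a₂ o) -
          prob p (PDEvent ends b a₂ a₃) * prob p (TEvent ends a₂ b a₃ ∩ connEvent ends a₂ o)) := by
    have h1 : 0 ≤ prob p (PDEvent ends b a₂ a₃) * prob p (TEvent ends b a₂ a₃ ∩ connEvent ends b o) +
        2 * prob p (PDEvent ends b a₂ a₃ ∩ connEvent ends b o) *
          (prob p (TEvent ends a₂ b a₃) + prob p (PDEvent ends b a₂ a₃)) :=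
      add_nonneg (mul_nonneg hD1 hMLH) (mul_nonneg (mul_nonneg (by norm_num) hMLN) (add_nonneg hXL hD1))
    have h2 := sub_nonneg.2 hP
    have h3 := sub_nonneg.2 hc
    have h4 : 0 ≤ prob p (PDEvent ends b a₂ a₃) * prob p (TEvent ends b a₂ a₃ ∩ connEvent ends b o) :=
      mul_nonneg hD1 hMLH
    exact add_nonneg (add_nonneg (add_nonneg h4 (mul_nonneg hZ1 h1)) (mul_nonneg hZ h2))
      (mul_nonneg (mul_nonneg (by norm_num) hZ1) h3)
  have hq2 : 0 ≤ p f * (1 - p f) ^ 2 := mul_nonneg hq0 (pow_nonneg hq1 2)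
  have hq3 : 0 ≤ p f ^ 2 * (1 - p f) := mul_nonneg (pow_nonneg hq0 2) hq1
  exact add_nonneg (mul_nonneg hq2 hU) (mul_nonneg hq3 (mul_nonneg (by norm_num) hC))

end TheoremB

/-- **(HCOV) when the root `a₂` is a leaf at `b`** (by the root symmetry `Gc_swap`). -/
theorem HCov_root_leaf_b' [Fintype V] [DecidableEq V] (p : E → R) (ends : E → Sym2 V)
    (hp : IsProbVec p) {f : E} {a₂ b : V} (hf : ends f = s(a₂, b))
    (hleaf : ∀ e, a₂ ∈ ends e → e = f) (h2b : a₂ ≠ b) {o a₁ a₃ : V} (h21 : a₂ ≠ a₁)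
    (h23 : a₂ ≠ a₃) (ho : o ≠ a₂) : HCov p ends o a₁ a₂ a₃ b :=
  (HCov_swap p ends o a₁ a₂ a₃ b).1 (HCov_root_leaf_b p ends hp hf hleaf h2b h21 h23 ho)

end RootLeafB

end Summit.Ventures.PercRepro2
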